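import Literature.AlgebraicGeometry.Morphisms.FlatClosedSubschemeEqNearFibreAffine
import Mathlib.AlgebraicGeometry.Morphisms.UniversallyClosed
import HarnessLib

/-!
# A flat closed subscheme read on ONE fibre is everything NEAR that fibre (Görtz–Wedhorn I, Lemma 14.21, globalised by a closed map)

Topic `Literature/AlgebraicGeometry/Morphisms`, namespace `Literature.AlgebraicGeometry.Morphisms`. THEOREMS only (no
definition, no instance, no notation, no named fact); universe-polymorphic `Scheme.{u}`; generic. Sequel of
`Morphisms/FlatClosedSubschemeEqNearFibreAffine` (the affine pointwise statement) and local twin of ★ `Morphisms/FlatClosedSubschemeEqOfFibres`.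

THE PRINT. Görtz–Wedhorn I, Lemma 14.21 and the proof of Prop. 14.28: let `p : X → T` be universally closed, `I ≤ J` quasi-coherent ideals
on `X` with `J` of finite type and `V(J)` flat over `T`; if `J ⊗ κ(t) ≤ I ⊗ κ(t)` on the ONE fibre `X_t`, then `I = J` near every point of
`X_t` (Lemma 14.21), the good locus is an open `W ⊇ X_t`, and `U := T ∖ p(X ∖ W)` is an open neighbourhood of `t` with `I = J` over `p⁻¹U`.

WHAT IS HERE.
* `IdealSheafData.ideal_eq_of_ideal_eq_of_le` — equality of two ideal sheaves on an affine open passes to its affine sub-opens (one-chart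
  `IdealSheafData.ext_of_iSup_eq_top` on the open subscheme).
* `IdealSheafData.comap_le_comap_of_isPullback_of_fiber_at` — one-point transport of the fibre inequality to any cartesian square over a field
  point at `t` (the one-point form of ★ `IdealSheafData.comap_le_comap_of_isPullback_of_fiber`).
* `IdealSheafData.exists_mem_ideal_eq_of_flat_of_fiber` — a good affine chart through every point of the fibre (general base; chart
  `p⁻¹V₀ → Spec Γ(T, V₀)`).
* **`IdealSheafData.exists_opens_comap_eq_of_flat_of_fiber`** — the local theorem: `∃ U ∋ t` open with `I = J` over `p⁻¹U`; and its
  field-point form `IdealSheafData.exists_opens_comap_eq_of_flat_of_fieldPoint` (ONE square over any `K ⊇ κ(t)`, reduced by ★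
  `IdealSheafData.comap_fiberι_le_of_isPullback`).

Consumer: `Morphisms/IsoOfFibreIsoFlatProper` (Görtz–Wedhorn I, Prop. 14.28) — cell `hodgecm-mathlib` FLOOR 0 ∕ P1, sub-line F-4, brick (B2)(ii).
HC_CM is proved only modulo the 7 printed citations until rung 0 closes — nothing here bears on a summit statement.

## References
* [GortzWedhorn2020] U. Görtz, T. Wedhorn, *Algebraic Geometry I: Schemes*, 2nd ed. (2020), Prop. 4.20 (p. 104), Example 4.36 (p. 112),
  Lemma 14.21, Proposition 14.28 (p. 438), Thm. 14.72 (p. 453).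
* [Matsumura1987] H. Matsumura, *Commutative Ring Theory* (1986/87), Theorem 22.5.
-/

noncomputable section

-- `TopCat.Presheaf` is not reducible (as in Mathlib's `AlgebraicGeometry/Modules` and ★ `Morphisms/FibreChartRing`).
set_option backward.isDefEq.respectTransparency false

open CategoryTheory CategoryTheory.Limits AlgebraicGeometry TopologicalSpace Opposite TensorProduct

universe u

namespace Literature.AlgebraicGeometry.Morphisms

section GoodAffine

variable {X : Scheme.{u}} {I J : X.IdealSheafData}

/-- Transport of `I(U) = J(U)` along an equality of the underlying opens of two affine opens (proof-irrelevance bookkeeping). [folklore] -/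
private theorem ideal_eq_transport (U₁ U₂ : X.affineOpens) (h : (U₁ : X.Opens) = U₂) (hh : I.ideal U₁ = J.ideal U₁) :
    I.ideal U₂ = J.ideal U₂ := by
  obtain ⟨U₁, h₁⟩ := U₁
  obtain ⟨U₂, h₂⟩ := U₂
  change U₁ = U₂ at h
  subst h
  exact hh

/-- **Equality of two ideal sheaves on an affine open passes to its affine sub-opens.** If `I(V) = J(V)` for an affine open `V`, then
`I(W) = J(W)` for every affine open `W ⊆ V`: restricted to the open subscheme `V` the two ideal sheaves agree on the affine chart `⊤`,
hence agree (Mathlib `IdealSheafData.ext_of_iSup_eq_top`), and `W` is the image of the affine open `V ∩ W` of `V`.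
[cite: GortzWedhorn2020, Example 4.36 (p. 112)] -/
theorem IdealSheafData.ideal_eq_of_ideal_eq_of_le {V W : X.affineOpens} (hV : I.ideal V = J.ideal V)
    (hWV : (W : X.Opens) ≤ V) : I.ideal W = J.ideal W := by
  haveI : IsAffine (V : X.Opens) := V.2
  have htop : IsAffineOpen (⊤ : (V : X.Opens).toScheme.Opens) := isAffineOpen_top _
  -- the restrictions to the open subscheme `V` agree
  have heq : I.comap (V : X.Opens).ι = J.comap (V : X.Opens).ι := by
    refine Scheme.IdealSheafData.ext_of_iSup_eq_top (fun _ : Unit => ⟨⊤, htop⟩) ?_ fun _ => ?_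
    · exact iSup_const
    · rw [Scheme.IdealSheafData.ideal_comap_of_isOpenImmersion, Scheme.IdealSheafData.ideal_comap_of_isOpenImmersion]
      have hVtop : (V : X.Opens).ι ''ᵁ (⊤ : (V : X.Opens).toScheme.Opens) = V := Scheme.Opens.ι_image_top _
      rw [ideal_eq_transport V ⟨_, htop.image_of_isOpenImmersion _⟩ hVtop.symm hV]
  -- evaluate at the affine open `V ∩ W = ι⁻¹ W` of `V`, whose image is `W`
  have hle : (W : X.Opens) ≤ (V : X.Opens).ι.opensRange := by rwa [Scheme.Opens.opensRange_ι]
  have hW' : IsAffineOpen ((V : X.Opens).ι ⁻¹ᵁ (W : X.Opens)) := W.2.preimage_of_isOpenImmersion (V : X.Opens).ι hle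
  have h := congrArg (fun K : (V : X.Opens).toScheme.IdealSheafData => K.ideal ⟨_, hW'⟩) heq
  simp only at h
  rw [Scheme.IdealSheafData.ideal_comap_of_isOpenImmersion, Scheme.IdealSheafData.ideal_comap_of_isOpenImmersion] at h
  have himg : (V : X.Opens).ι ''ᵁ ((V : X.Opens).ι ⁻¹ᵁ (W : X.Opens)) = W := by
    rw [Scheme.Hom.image_preimage_eq_opensRange_inf, Scheme.Opens.opensRange_ι, inf_eq_right.mpr hWV]
  have hsurj : Function.Surjective ((V : X.Opens).ι.appIso ((V : X.Opens).ι ⁻¹ᵁ (W : X.Opens))).inv.hom :=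
    ((V : X.Opens).ι.appIso ((V : X.Opens).ι ⁻¹ᵁ (W : X.Opens))).symm.commRingCatIsoToRingEquiv.surjective
  exact ideal_eq_transport ⟨_, hW'.image_of_isOpenImmersion _⟩ W himg (Ideal.comap_injective_of_surjective _ hsurj h)

end GoodAffine

section OnePointTransport

variable {X T : Scheme.{u}} (p : X ⟶ T) {I J : X.IdealSheafData}

/-- **One-point transport.** If `J_t ≤ I_t` on the canonical fibre `X_t = p.fiber t`, then `J_Y ≤ I_Y` on EVERY cartesian square
`Y = X ×_T Spec K` over a field point `x : Spec K → T` AT `t` (`x(pt) = t`): `x` factors as `Spec K → Spec κ(t) → T`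
(Mathlib `Scheme.descResidueField`), so `Y ≅ X_t ×_{κ(t)} K → X_t → X`, and `comap` is functorial and monotone — the one-point form of
★ `IdealSheafData.comap_le_comap_of_isPullback_of_fiber`. [cite: GortzWedhorn2020, Prop. 4.20 (p. 104)] -/
theorem IdealSheafData.comap_le_comap_of_isPullback_of_fiber_at (t : T)
    (hfib : J.comap (p.fiberι t) ≤ I.comap (p.fiberι t))
    {K : Type u} [Field K] (x : Spec (.of K) ⟶ T) (hx : x.base (IsLocalRing.closedPoint K) = t)
    {Y : Scheme.{u}} (g : Y ⟶ X) (y : Y ⟶ Spec (.of K)) (h : IsPullback g y p x) : J.comap g ≤ I.comap g := by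
  subst hx
  set t := x.base (IsLocalRing.closedPoint K) with ht
  let φ : T.residueField t ⟶ .of K := T.descResidueField (Scheme.stalkClosedPointTo x)
  have hxφ : Spec.map φ ≫ T.fromSpecResidueField t = x :=
    Scheme.descResidueField_stalkClosedPointTo_fromSpecResidueField K T x
  have sqf : IsPullback (p.fiberι t) (p.fiberToSpecResidueField t) p (T.fromSpecResidueField t) :=
    IsPullback.of_hasPullback _ _
  have sq : IsPullback (pullback.fst (p.fiberToSpecResidueField t) (Spec.map φ) ≫ p.fiberι t)
      (pullback.snd (p.fiberToSpecResidueField t) (Spec.map φ)) p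
      (Spec.map φ ≫ T.fromSpecResidueField t) :=
    (IsPullback.of_hasPullback _ _).paste_horiz sqf
  rw [hxφ] at sq
  have hg : g = (h.isoIsPullback _ _ sq).hom ≫ pullback.fst (p.fiberToSpecResidueField t) (Spec.map φ) ≫
      p.fiberι t := by
    rw [IsPullback.isoIsPullback_hom_fst]
  rw [hg, Scheme.IdealSheafData.comap_comp, Scheme.IdealSheafData.comap_comp,
    Scheme.IdealSheafData.comap_comp, Scheme.IdealSheafData.comap_comp]
  exact Scheme.IdealSheafData.comap_mono _ (Scheme.IdealSheafData.comap_mono _ hfib)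

end OnePointTransport

section LocalTheorem

variable {X T : Scheme.{u}} (p : X ⟶ T) {I J : X.IdealSheafData} (hIJ : I ≤ J)

include hIJ in
/-- **A good affine chart through every point of the fibre.** `p : X → T`, `I ≤ J` ideal sheaves on `X`, `J` of finite type, `V(J) → T`
flat; if `J_t ≤ I_t` on the fibre `X_t`, then every point `x` over `t` has an affine neighbourhood `V` with `I(V) = J(V)` (chart
`p⁻¹V₀ → Spec Γ(T, V₀)` over an affine `V₀ ∋ t`, then `IdealSheafData.exists_mem_ideal_eq_of_flat_of_isPullback_at`).
[cite: GortzWedhorn2020, Lemma 14.21] -/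
theorem IdealSheafData.exists_mem_ideal_eq_of_flat_of_fiber (hJ : ∀ U : X.affineOpens, (J.ideal U).FG)
    [Flat (J.subschemeι ≫ p)] (t : T) (hfib : J.comap (p.fiberι t) ≤ I.comap (p.fiberι t))
    (x : X) (hx : p.base x = t) :
    ∃ V : X.affineOpens, x ∈ (V : X.Opens) ∧ I.ideal V = J.ideal V := by
  -- an affine `V₀ ∋ t` and the chart `F : p⁻¹V₀ → Spec Γ(T, V₀)`
  obtain ⟨V₀, hV₀, htV₀, -⟩ := exists_isAffineOpen_mem_and_subset (X := T) (x := t) (U := ⊤) trivial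
  have hxV₀ : x ∈ p ⁻¹ᵁ V₀ := by
    change p.base x ∈ V₀
    rwa [hx]
  let x' : ↑(p ⁻¹ᵁ V₀) := ⟨x, hxV₀⟩
  let F : (↑(p ⁻¹ᵁ V₀) : Scheme.{u}) ⟶ Spec Γ(T, V₀) := p ∣_ V₀ ≫ hV₀.isoSpec.hom
  haveI := flat_comap_subschemeι_comp_chart p J hV₀
  have hIJ' : I.comap (p ⁻¹ᵁ V₀).ι ≤ J.comap (p ⁻¹ᵁ V₀).ι := Scheme.IdealSheafData.comap_mono _ hIJ
  have hJ' : ∀ U : (↑(p ⁻¹ᵁ V₀) : Scheme.{u}).affineOpens, ((J.comap (p ⁻¹ᵁ V₀).ι).ideal U).FG := by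
    intro U
    rw [ideal_comap_ι_eq p J U]
    exact hJ _
  -- the point of `T` hit by the chart at `x'` is `t`
  have hFx : hV₀.fromSpec.base (F.base x') = t := by
    rw [← Scheme.Hom.comp_apply]
    change ((p ∣_ V₀ ≫ hV₀.isoSpec.hom) ≫ hV₀.fromSpec).base x' = t
    rw [Category.assoc, IsAffineOpen.isoSpec_hom_fromSpec, morphismRestrict_ι, Scheme.Hom.comp_apply]
    exact hx
  obtain ⟨V', hxV', hV'⟩ := IdealSheafData.exists_mem_ideal_eq_of_flat_of_isPullback_at F hIJ' hJ' x' (by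
    intro K _ xK hxK Y g y hP
    have hsq : IsPullback (g ≫ (p ⁻¹ᵁ V₀).ι) y p (xK ≫ hV₀.fromSpec) :=
      hP.paste_horiz (isPullback_ι_morphismRestrict_isoSpec p hV₀)
    have hpt : (xK ≫ hV₀.fromSpec).base (IsLocalRing.closedPoint K) = t := by
      rw [Scheme.Hom.comp_apply, hxK, hFx]
    have hle := IdealSheafData.comap_le_comap_of_isPullback_of_fiber_at p t hfib (xK ≫ hV₀.fromSpec) hpt
      (g ≫ (p ⁻¹ᵁ V₀).ι) y hsq
    rwa [Scheme.IdealSheafData.comap_comp, Scheme.IdealSheafData.comap_comp] at hle)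
  -- back to `X` along the open immersion `p⁻¹V₀ → X`
  refine ⟨⟨(p ⁻¹ᵁ V₀).ι ''ᵁ (V' : (↑(p ⁻¹ᵁ V₀) : Scheme.{u}).Opens), V'.2.image_of_isOpenImmersion _⟩,
    ⟨x', hxV', rfl⟩, ?_⟩
  rw [← ideal_comap_ι_eq p I V', ← ideal_comap_ι_eq p J V']
  exact hV'

include hIJ in
/-- **A flat closed subscheme read on one fibre is everything near that fibre** (local form of ★ `IdealSheafData.eq_of_le_of_flat_of_fiber`;
[GortzWedhorn2020] Lemma 14.21 globalised by a closed map). Let `p : X → T` be universally closed, `I ≤ J` ideal sheaves on `X` with `J`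
of finite type and `V(J) → T` flat. If `J_t ≤ I_t` on the fibre `X_t` for ONE `t ∈ T`, then there is an open `U ∋ t` with `I = J` over
`p⁻¹U`: the good affine charts of `IdealSheafData.exists_mem_ideal_eq_of_flat_of_fiber` cover an open `W ⊇ X_t`, `U := T ∖ p(X ∖ W)`, and
two ideal sheaves agreeing on a cover by affine opens agree. [cite: GortzWedhorn2020, Lemma 14.21 and Prop. 14.28 (p. 438)] -/
theorem IdealSheafData.exists_opens_comap_eq_of_flat_of_fiber [UniversallyClosed p]
    (hJ : ∀ U : X.affineOpens, (J.ideal U).FG) [Flat (J.subschemeι ≫ p)] (t : T)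
    (hfib : J.comap (p.fiberι t) ≤ I.comap (p.fiberι t)) :
    ∃ U : T.Opens, t ∈ U ∧ I.comap (p ⁻¹ᵁ U).ι = J.comap (p ⁻¹ᵁ U).ι := by
  -- a good affine chart `V x` through every point `x` of the fibre
  have hgood := IdealSheafData.exists_mem_ideal_eq_of_flat_of_fiber p hIJ hJ t hfib
  choose V hxV hV using hgood
  -- their union `W` and `U := T ∖ p(X ∖ W)`
  set W : X.Opens := ⨆ x : {x : X // p.base x = t}, (V x.1 x.2 : X.Opens) with hW
  have hfibW : ∀ x : X, p.base x = t → x ∈ W := fun x hx =>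
    Opens.mem_iSup.mpr ⟨⟨x, hx⟩, hxV x hx⟩
  have hcl : IsClosed (p.base '' ((W : Set X)ᶜ)) := p.isClosedMap _ W.isOpen.isClosed_compl
  let U : T.Opens := ⟨(p.base '' ((W : Set X)ᶜ))ᶜ, hcl.isOpen_compl⟩
  have htU : t ∈ U := by
    rintro ⟨x, hx, hxt⟩
    exact hx (hfibW x hxt)
  have hUW : p ⁻¹ᵁ U ≤ W := by
    intro x hx
    by_contra hxW
    exact hx ⟨x, hxW, rfl⟩
  refine ⟨U, htU, ?_⟩
  -- the affine opens of `p⁻¹U` inside some `V x` cover `p⁻¹U`, and there `I = J`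
  refine Scheme.IdealSheafData.ext_of_iSup_eq_top
    (ι := Σ x : {x : X // p.base x = t}, {W' : (↑(p ⁻¹ᵁ U) : Scheme.{u}).affineOpens //
      (p ⁻¹ᵁ U).ι ''ᵁ (W' : (↑(p ⁻¹ᵁ U) : Scheme.{u}).Opens) ≤ (V x.1 x.2 : X.Opens)})
    (fun i => i.2.1) ?_ ?_
  · rw [eq_top_iff]
    rintro y -
    have hy : (p ⁻¹ᵁ U).ι.base y ∈ W := hUW y.2
    obtain ⟨x, hx⟩ := Opens.mem_iSup.mp hy
    obtain ⟨W', hW', hyW', hW'V⟩ := exists_isAffineOpen_mem_and_subset (X := ↑(p ⁻¹ᵁ U)) (x := y)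
      (U := (p ⁻¹ᵁ U).ι ⁻¹ᵁ (V x.1 x.2 : X.Opens)) hx
    refine Opens.mem_iSup.mpr ⟨⟨x, ⟨⟨W', hW'⟩, ?_⟩⟩, hyW'⟩
    rintro _ ⟨z, hz, rfl⟩
    exact hW'V hz
  · rintro ⟨x, ⟨W', hW'V⟩⟩
    dsimp only
    rw [ideal_comap_ι_eq p I W', ideal_comap_ι_eq p J W']
    exact IdealSheafData.ideal_eq_of_ideal_eq_of_le (hV x.1 x.2) hW'V

include hIJ in
/-- The same with the fibre hypothesis in FIELD-POINT form: ONE field point `x : Spec K → T` at `t` (`K ⊇ κ(t)` arbitrary) and ONE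
cartesian square `X_K = X ×_T Spec K` on which `J_K ≤ I_K` (reduced to the canonical fibre by ★ `IdealSheafData.comap_fiberι_le_of_isPullback`,
faithfully flat descent along `X_K → X_t`). [cite: GortzWedhorn2020, Prop. 14.28 (p. 438) and Thm. 14.72 (p. 453)] -/
theorem IdealSheafData.exists_opens_comap_eq_of_flat_of_fieldPoint [UniversallyClosed p]
    (hJ : ∀ U : X.affineOpens, (J.ideal U).FG) [Flat (J.subschemeι ≫ p)]
    {K : Type u} [Field K] (x : Spec (.of K) ⟶ T) {XK : Scheme.{u}} (i : XK ⟶ X) (fK : XK ⟶ Spec (.of K))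
    (h : IsPullback i fK p x) (hle : J.comap i ≤ I.comap i) :
    ∃ U : T.Opens, x.base (IsLocalRing.closedPoint K) ∈ U ∧ I.comap (p ⁻¹ᵁ U).ι = J.comap (p ⁻¹ᵁ U).ι :=
  IdealSheafData.exists_opens_comap_eq_of_flat_of_fiber p hIJ hJ _
    (IdealSheafData.comap_fiberι_le_of_isPullback p x i fK h hle)

end LocalTheorem

end Literature.AlgebraicGeometry.Morphisms

end
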